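import Mathlib
import HarnessLib
import Literature.Computability.AlgebraicComplexity.DegenerationSpectralMonotone
import Summits.MatrixMultiplication.MatrixMultiplication.Theorems.OutsiderSandwichDegenerationBridge
import Summits.MatrixMultiplication.MatrixMultiplication.Theorems.OutsiderSandwichUnitKroneckerRigidity
import Summits.MatrixMultiplication.MatrixMultiplication.Theorems.OutsiderSandwichNoExactPerfectPacking

/-!
# OutsiderSandwich — border-subrank CEILING of the `cw₂`-tower: `cw₂^{⊠N} ⋭ ⟨3^N⟩` (`N ≥ 1`)
(decomp-mm lens 4 «minimal-counterexample / extremal reduction», gen 42, kernel K42-f; THESES-FREE,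
definition-free)

Companion to K42-e (`OutsiderSandwichBorderSubrankSeven`: `⟨7⟩ ⊴₄ cw₂^{⊠2}`, so the border subrank
of `cw₂^{⊠2}` is `≥ 7 > 6 =` its subrank).  This file closes the window from above, for every level:

* `cwTwoPow_not_degeneratesTo_unitPow` — for every `N ≥ 1` and EVERY identification `e` of the
  formats, `⟨1⟩ ⊠ cw₂^{⊠N}` does not degenerate (orbit closure, CVZ Rem. 1.2) to `e^*(⟨3^N⟩ ⊠ ⟨1,1,1⟩)`:
  both tensors are polystable (`OutsiderSandwichUnitKroneckerRigidity`), so by Kempf–Ness rigidity a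
  degeneration would be a restriction, and `⟨3^N⟩ ⊠ ⟨1,1,1⟩ ≰ cw₂^{⊠N}`
  (`OutsiderSandwichNoExactPerfectPacking.not_unit_three_pow_le_cwPow`, support functionals).
* `cwTwoPow_not_algDegeneratesTo_unitPow` — the same in the BCS currency of K42-d/K42-e:
  **`¬ AlgDegeneratesTo (kroneckerPow (cwTensor ℂ 2) N) (unitTensor ℂ (3 ^ N))`** for `N ≥ 1`, i.e.
  the border subrank of `cw₂^{⊠N}` is at most `3^N − 1` (bridge
  `not_algDegeneratesTo_of_not_degeneratesTo_relabel` + the padding restrictions `t ≥ ⟨1⟩ ⊠ t ≥ t`,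
  `t ≥ t ⊠ ⟨1,1,1⟩` proved here).
* `N = 2`: `not_unitTensor_nine_deg_cwTwoPow_two`; with K42-e the border subrank of `cw₂^{⊠2}` is `7`
  or `8` (no size-`8` diagonal of the support of `cw₂ ⊠ cw₂`, in either the `cw`- or the `D`-basis, is a
  COMBINATORIAL degeneration — exhaustive LP, `combdeg7.py`; a general degeneration to `⟨8⟩` is open).

Census reading: the degeneration-order diagonal column of the lens' census is now bracketed at every
level, `Q̲(cw₂^{⊠N}) ≤ 3^N − 1`, exactly like the restriction column (`Q ≤ 3^N − (2^N−1)/2`,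
`OutsiderSandwichPackingSlack`); at `N = 2`: `Q = 6 < 7 ≤ Q̲ ≤ 8`.

References: [cite: KempfNess1979, Thm. 0.2]; [cite: BurgisserIkenmeyer2017, §4.2, Cor. 4.9];
[cite: BurgisserClausenShokrollahi1997, (15.19), (15.25)]; [cite: ChristandlVranaZuiddam2023, Rem. 1.2].
-/

set_option linter.dupNamespace false

noncomputable section

namespace Summit.MatrixMultiplication.MatrixMultiplication.Theorems.OutsiderSandwichBorderSubrankCeiling

open scoped BigOperators
open Literature.Computability.AlgebraicComplexity
open OutsiderSandwichUnitKroneckerRigidity OutsiderSandwichDegenerationBridge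

/-! ## Padding restrictions -/

/-- `t ≥ ⟨1⟩ ⊠ t`. [folklore] -/
theorem restrictsTo_unitOne_kronecker {ι κ μ : Type} [Fintype ι] [Fintype κ] [Fintype μ]
    [DecidableEq ι] [DecidableEq κ] [DecidableEq μ] (t : ι → κ → μ → ℂ) :
    TensorRestrictsTo t (kroneckerTensor (unitTensor ℂ 1) t) := by
  refine ⟨fun x a => if a = x.2 then 1 else 0, fun y b => if b = y.2 then 1 else 0,
    fun z c => if c = z.2 then 1 else 0, fun x y z => ?_⟩
  simp only [kroneckerTensor, unitTensor_one, one_mul]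
  rw [Finset.sum_eq_single x.2 (fun a _ ha => by simp [ha]) (by simp)]
  rw [Finset.sum_eq_single y.2 (fun b _ hb => by simp [hb]) (by simp)]
  rw [Finset.sum_eq_single z.2 (fun c _ hc => by simp [hc]) (by simp)]
  simp

/-- `⟨1⟩ ⊠ t ≥ t`. [folklore] -/
theorem unitOne_kronecker_restrictsTo {ι κ μ : Type} [Fintype ι] [Fintype κ] [Fintype μ]
    [DecidableEq ι] [DecidableEq κ] [DecidableEq μ] (t : ι → κ → μ → ℂ) :
    TensorRestrictsTo (kroneckerTensor (unitTensor ℂ 1) t) t := by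
  refine ⟨fun x a => if a.2 = x then 1 else 0, fun y b => if b.2 = y then 1 else 0,
    fun z c => if c.2 = z then 1 else 0, fun x y z => ?_⟩
  simp only [kroneckerTensor, unitTensor_one, one_mul]
  rw [Finset.sum_eq_single ((0 : Fin 1), x) (fun a _ ha => by
      have : a.2 ≠ x := fun h => ha (Prod.ext (Subsingleton.elim _ _) h)
      simp [this]) (by simp)]
  rw [Finset.sum_eq_single ((0 : Fin 1), y) (fun b _ hb => by
      have : b.2 ≠ y := fun h => hb (Prod.ext (Subsingleton.elim _ _) h)
      simp [this]) (by simp)]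
  rw [Finset.sum_eq_single ((0 : Fin 1), z) (fun c _ hc => by
      have : c.2 ≠ z := fun h => hc (Prod.ext (Subsingleton.elim _ _) h)
      simp [this]) (by simp)]
  simp

/-- `⟨1,1,1⟩` is the constant tensor `1`. [folklore] -/
theorem matMulTensor_one (i j k : Fin 1 × Fin 1) : matMulTensor ℂ 1 1 1 i j k = 1 := by
  have h : i.1 = j.1 ∧ j.2 = k.1 ∧ i.2 = k.2 :=
    ⟨Subsingleton.elim _ _, Subsingleton.elim _ _, Subsingleton.elim _ _⟩
  simp [matMulTensor, h]

/-- `t ≥ t ⊠ ⟨1,1,1⟩`. [folklore] -/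
theorem restrictsTo_kronecker_matMulOne {ι κ μ : Type} [Fintype ι] [Fintype κ] [Fintype μ]
    [DecidableEq ι] [DecidableEq κ] [DecidableEq μ] (t : ι → κ → μ → ℂ) :
    TensorRestrictsTo t (kroneckerTensor t (matMulTensor ℂ 1 1 1)) := by
  refine ⟨fun x a => if a = x.1 then 1 else 0, fun y b => if b = y.1 then 1 else 0,
    fun z c => if c = z.1 then 1 else 0, fun x y z => ?_⟩
  simp only [kroneckerTensor, matMulTensor_one, mul_one]
  rw [Finset.sum_eq_single x.1 (fun a _ ha => by simp [ha]) (by simp)]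
  rw [Finset.sum_eq_single y.1 (fun b _ hb => by simp [hb]) (by simp)]
  rw [Finset.sum_eq_single z.1 (fun c _ hc => by simp [hc]) (by simp)]
  simp

/-! ## The ceiling -/

/-- **`⟨1⟩ ⊠ cw₂^{⊠N} ⋭ e^*(⟨3^N⟩ ⊠ ⟨1,1,1⟩)`** (orbit-closure degeneration, `N ≥ 1`, every
identification `e` of the formats): both sides are polystable, so a degeneration would be a two-sided
restriction (`unitKronecker_restricts_both_of_degeneratesTo`), and `⟨3^N⟩ ⊠ ⟨1,1,1⟩ ≰ cw₂^{⊠N}`.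
[cite: KempfNess1979, Thm. 0.2; BurgisserIkenmeyer2017, §4.2] -/
theorem cwTwoPow_not_degeneratesTo_unitPow {N : ℕ} (hN : 1 ≤ N)
    (e : (Fin 1 × (Fin N → Fin 3)) ≃ (Fin (3 ^ N) × (Fin 1 × Fin 1))) :
    ¬ TensorDegeneratesTo (kroneckerTensor (unitTensor ℂ 1) (kroneckerPow (cwTensor ℂ 2) N))
      (fun a b c => kroneckerTensor (unitTensor ℂ (3 ^ N)) (matMulTensor ℂ 1 1 1) (e a) (e b) (e c)) := by
  intro hdeg
  have h := (unitKronecker_restricts_both_of_degeneratesTo (by positivity) one_pos e hdeg).1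
  exact OutsiderSandwichNoExactPerfectPacking.not_unit_three_pow_le_cwPow hN
    ((restrictsTo_unitOne_kronecker _).trans h)

/-- **Border-subrank ceiling `Q̲(cw₂^{⊠N}) ≤ 3^N − 1`** in the BCS currency: for `N ≥ 1`, the unit
tensor `⟨3^N⟩` is NOT an algebraic degeneration (any order) of `cw₂^{⊠N}`.
[cite: BurgisserClausenShokrollahi1997, (15.25); KempfNess1979, Thm. 0.2] -/
theorem cwTwoPow_not_algDegeneratesTo_unitPow {N : ℕ} (hN : 1 ≤ N) :
    ¬ AlgDegeneratesTo (kroneckerPow (cwTensor ℂ 2) N) (unitTensor ℂ (3 ^ N)) := by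
  intro hdeg
  -- pad both sides: `⟨1⟩ ⊠ cw₂^{⊠N} ≥ cw₂^{⊠N} ⊵ ⟨3^N⟩ ≥ ⟨3^N⟩ ⊠ ⟨1,1,1⟩`
  have h₁ : AlgDegeneratesTo (kroneckerTensor (unitTensor ℂ 1) (kroneckerPow (cwTensor ℂ 2) N))
      (kroneckerTensor (unitTensor ℂ (3 ^ N)) (matMulTensor ℂ 1 1 1)) :=
    ((unitOne_kronecker_restrictsTo _).algDegeneratesTo_trans hdeg).trans_restrictsTo
      (restrictsTo_kronecker_matMulOne _)
  have hcard : Fintype.card (Fin 1 × (Fin N → Fin 3)) =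
      Fintype.card (Fin (3 ^ N) × (Fin 1 × Fin 1)) := by simp
  obtain ⟨e⟩ := Fintype.truncEquivOfCardEq hcard |>.nonempty
  exact not_algDegeneratesTo_of_not_degeneratesTo_relabel e (cwTwoPow_not_degeneratesTo_unitPow hN e) h₁

/-- **`N = 2`: `⟨9⟩ ⋬ cw₂^{⊠2}`** — the border subrank of the Kronecker square of `T_{cw,2}` is at most
`8` (and at least `7`, K42-e). [cite: KempfNess1979, Thm. 0.2] -/
theorem not_unitTensor_nine_deg_cwTwoPow_two :
    ¬ AlgDegeneratesTo (kroneckerPow (cwTensor ℂ 2) 2) (unitTensor ℂ 9) :=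
  cwTwoPow_not_algDegeneratesTo_unitPow (N := 2) (by norm_num)

/-- `N = 3`: `⟨27⟩ ⋬ cw₂^{⊠3}`. [cite: KempfNess1979, Thm. 0.2] -/
theorem not_unitTensor_twentySeven_deg_cwTwoPow_three :
    ¬ AlgDegeneratesTo (kroneckerPow (cwTensor ℂ 2) 3) (unitTensor ℂ 27) :=
  cwTwoPow_not_algDegeneratesTo_unitPow (N := 3) (by norm_num)

end Summit.MatrixMultiplication.MatrixMultiplication.Theorems.OutsiderSandwichBorderSubrankCeiling

end
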